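import Summits.KontsevichZagierPeriods.KontsevichZagierPeriods.Theorems.TerasomaMultiplicationMultiplicationAccessibleCornerStokesYFibre
import Summits.KontsevichZagierPeriods.KontsevichZagierPeriods.Theorems.TerasomaMultiplicationMultiplicationAccessibleCornerFieldGen

/-!
# `MultiplicationAccessible` (stmt-KontsevichZagierPeriods-12305), line `shifted-family-prime-sieve`:
one-variable calculus of the `y`-fibres of the corner Stokes component `V_y`, dimension `p = n + 2`

Auxiliary file of `cornerYDerivBoundGen` (the derivative-bound core of the exceptional-face move of
the general-`p` corner Stokes).  Along a `y`-fibre of the chart domain only `y` moves: the weights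
`θ_k` (`Σ_k θ_k = 1`) and `v` are constants, the box coordinates are `t_k = 1 − yθ_k ∈ (0,1)`, and
the atoms of `V_y = v^{px−1}(1 − vZ)^{ps−1}H^{ps}K·Σ_kθ_kM_k` are elementary functions of one real
variable: `Z = (∏ t_k)^{1/p}`, the Vieta polynomial `S` (`yS = 1 − ∏ t_k`), `H = (Σ_{j<p} Z^j)/S`,
the cyclic monomials `M_k = t_k^x ∏_j t_{k+j+1}^{x+(j+1)/p−1}`.  This file records their
derivatives (`HasDerivAt`, product/chain rule) and the elementary ranges used for the uniform
bound of `∂_y V_y` (`|∂_y ∏t| ≤ 1`, `|∂_y S| ≤ (2p)^{p+1}`, `S ≥ 1/p`, `0 ≤ M_k ≤ ∏ t`,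
`|∂_y M_k| ≤ px` — the last packaged as the registered sub-goal `cornerYDerivBoundGenAux`), and the
pole-absorbing estimates (the poles `1/t_k` of `∂_y Z` are absorbed by `Σθ_kM_k ≤ ∏ t_k`) with the
final three-term assembly.  The fibre derivative itself (`CornerYDerivBound.fibre`) and the stub
`cornerYDerivBoundGen` are in `…CornerYDerivBoundGen`.  Dimension-`p` version of
`…CornerStokesYFibre{,Deriv}` (`p = 3`).

References: M. Kontsevich, D. Zagier, *Periods* (2001), §1.2 rule (3).
-/

noncomputable section

open Set Real Finset
open scoped BigOperators

namespace Summit.KontsevichZagierPeriods.TerasomaMultiplication.MultiplicationAccessible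

namespace CornerYDerivBound

variable {n : ℕ}

/-- Derivative of the box product `a ↦ ∏_k (1 − aθ_k)` (product rule). [folklore] -/
theorem hasDerivAt_prodT (θ : Fin (n + 2) → ℝ) (y : ℝ) :
    HasDerivAt (fun a => ∏ k, (1 - a * θ k))
      (∑ k, (∏ l ∈ Finset.univ.erase k, (1 - y * θ l)) * (-θ k)) y := by
  have dt : ∀ k ∈ (Finset.univ : Finset (Fin (n + 2))),
      HasDerivAt (fun a : ℝ => 1 - a * θ k) (-θ k) y := fun k _ => by
    simpa using ((hasDerivAt_id y).mul_const (θ k)).const_sub 1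
  have h := HasDerivAt.fun_finsetProd dt
  simp only [smul_eq_mul] at h
  exact h

/-- `|∂_a ∏_k (1 − aθ_k)| ≤ Σ_k θ_k = 1` when all `1 − yθ_l ∈ [0,1]` and `θ ≥ 0`. [folklore] -/
theorem abs_prodT_deriv_le {θ : Fin (n + 2) → ℝ} {y : ℝ} (hθ : ∀ k, 0 ≤ θ k)
    (hsum : ∑ k, θ k = 1) (ht0 : ∀ k, 0 ≤ 1 - y * θ k) (ht1 : ∀ k, 1 - y * θ k ≤ 1) :
    |∑ k, (∏ l ∈ Finset.univ.erase k, (1 - y * θ l)) * (-θ k)| ≤ 1 := by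
  calc |∑ k, (∏ l ∈ Finset.univ.erase k, (1 - y * θ l)) * (-θ k)|
      ≤ ∑ k, |(∏ l ∈ Finset.univ.erase k, (1 - y * θ l)) * (-θ k)| :=
        Finset.abs_sum_le_sum_abs _ _
    _ ≤ ∑ k, θ k := Finset.sum_le_sum fun k _ => by
        rw [abs_mul, abs_neg, abs_of_nonneg (hθ k),
          abs_of_nonneg (Finset.prod_nonneg fun l _ => ht0 l)]
        exact mul_le_of_le_one_left (hθ k)
          (Finset.prod_le_one (fun l _ => ht0 l) fun l _ => ht1 l)
    _ = 1 := hsum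

/-- Derivative of the geometric mean `Z = (∏_k (1 − aθ_k))^{1/p}` along `a`:
`Z' = Z·(∏t)'/(p·∏t)`. [folklore] -/
theorem hasDerivAt_Z {θ : Fin (n + 2) → ℝ} {y : ℝ} (hpos : 0 < ∏ k, (1 - y * θ k))
    (Zf : ℝ → ℝ) (hZf : ∀ a, Zf a = (∏ k, (1 - a * θ k)) ^ (1 / ((n:ℝ) + 2))) :
    HasDerivAt Zf (Zf y * (∑ k, (∏ l ∈ Finset.univ.erase k, (1 - y * θ l)) * (-θ k)) /
      (((n:ℝ) + 2) * ∏ k, (1 - y * θ k))) y := by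
  have h := (hasDerivAt_prodT θ y).rpow_const (p := 1 / ((n:ℝ) + 2)) (Or.inl hpos.ne')
  refine (h.congr_of_eventuallyEq (Filter.Eventually.of_forall hZf)).congr_deriv ?_
  rw [Real.rpow_sub_one hpos.ne', ← hZf]
  have hp : (n:ℝ) + 2 ≠ 0 := by positivity
  field_simp

/-- Derivative of the Vieta polynomial `S = Σ_{j<p} (−1)^j a^j e_{j+1}(θ)` along `a`. [folklore] -/
theorem hasDerivAt_S (θ : Fin (n + 2) → ℝ) (y : ℝ) (Sf : ℝ → ℝ)
    (hSf : ∀ a, Sf a = ∑ j ∈ Finset.range (n + 2), (-1:ℝ) ^ j * a ^ j *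
      ∑ A ∈ Finset.powersetCard (j + 1) (Finset.univ : Finset (Fin (n + 2))), ∏ k ∈ A, θ k) :
    HasDerivAt Sf (∑ j ∈ Finset.range (n + 2), (-1:ℝ) ^ j * ((j:ℝ) * y ^ (j - 1)) *
      ∑ A ∈ Finset.powersetCard (j + 1) (Finset.univ : Finset (Fin (n + 2))), ∏ k ∈ A, θ k) y := by
  have h : ∀ j ∈ Finset.range (n + 2), HasDerivAt (fun a : ℝ => (-1:ℝ) ^ j * a ^ j *
      ∑ A ∈ Finset.powersetCard (j + 1) (Finset.univ : Finset (Fin (n + 2))), ∏ k ∈ A, θ k)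
      ((-1:ℝ) ^ j * ((j:ℝ) * y ^ (j - 1)) *
        ∑ A ∈ Finset.powersetCard (j + 1) (Finset.univ : Finset (Fin (n + 2))), ∏ k ∈ A, θ k) y :=
    fun j _ => ((hasDerivAt_pow j y).const_mul _).mul_const _
  exact (HasDerivAt.fun_sum h).congr_of_eventuallyEq (Filter.Eventually.of_forall hSf)

/-- The elementary symmetric functions of weights in `[0,1]` lie in `[0, 2^p]`. [folklore] -/
theorem sigma_mem {θ : Fin (n + 2) → ℝ} (hθ0 : ∀ k, 0 ≤ θ k) (hθ1 : ∀ k, θ k ≤ 1) (m : ℕ) :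
    0 ≤ ∑ A ∈ Finset.powersetCard m (Finset.univ : Finset (Fin (n + 2))), ∏ k ∈ A, θ k ∧
      ∑ A ∈ Finset.powersetCard m (Finset.univ : Finset (Fin (n + 2))), ∏ k ∈ A, θ k ≤
        (2:ℝ) ^ (n + 2) := by
  refine ⟨Finset.sum_nonneg fun A _ => Finset.prod_nonneg fun k _ => hθ0 k, ?_⟩
  calc ∑ A ∈ Finset.powersetCard m (Finset.univ : Finset (Fin (n + 2))), ∏ k ∈ A, θ k
      ≤ ∑ _A ∈ Finset.powersetCard m (Finset.univ : Finset (Fin (n + 2))), (1:ℝ) :=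
        Finset.sum_le_sum fun A _ => Finset.prod_le_one (fun k _ => hθ0 k) fun k _ => hθ1 k
    _ = ((n + 2).choose m : ℕ) := by
        rw [Finset.sum_const, nsmul_eq_mul, mul_one, Finset.card_powersetCard, Finset.card_univ,
          Fintype.card_fin]
    _ ≤ (2:ℝ) ^ (n + 2) := by exact_mod_cast Nat.choose_le_two_pow (n + 2) m

/-- `|∂_y S| ≤ (2p)^{p+1}` for `0 ≤ y ≤ p` and weights in `[0,1]`. [folklore] -/
theorem abs_Sd_le {θ : Fin (n + 2) → ℝ} {y : ℝ} (hθ0 : ∀ k, 0 ≤ θ k) (hθ1 : ∀ k, θ k ≤ 1)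
    (hy0 : 0 ≤ y) (hyp : y ≤ (n:ℝ) + 2) :
    |∑ j ∈ Finset.range (n + 2), (-1:ℝ) ^ j * ((j:ℝ) * y ^ (j - 1)) *
      ∑ A ∈ Finset.powersetCard (j + 1) (Finset.univ : Finset (Fin (n + 2))), ∏ k ∈ A, θ k| ≤
      (2 * ((n:ℝ) + 2)) ^ (n + 3) := by
  have hp1 : (1:ℝ) ≤ (n:ℝ) + 2 := by have : (0:ℝ) ≤ n := n.cast_nonneg; linarith
  have hterm : ∀ j ∈ Finset.range (n + 2), |(-1:ℝ) ^ j * ((j:ℝ) * y ^ (j - 1)) *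
      ∑ A ∈ Finset.powersetCard (j + 1) (Finset.univ : Finset (Fin (n + 2))), ∏ k ∈ A, θ k| ≤
      (2 * ((n:ℝ) + 2)) ^ (n + 2) := by
    intro j hj
    have hj' : j < n + 2 := Finset.mem_range.1 hj
    have hjR : (j:ℝ) ≤ (n:ℝ) + 2 := by exact_mod_cast hj'.le
    obtain ⟨hσ0, hσ1⟩ := sigma_mem hθ0 hθ1 (j + 1)
    have hyj : y ^ (j - 1) ≤ ((n:ℝ) + 2) ^ (n + 1) :=
      (pow_le_pow_left₀ hy0 hyp _).trans (pow_le_pow_right₀ hp1 (by omega))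
    rw [abs_mul, abs_mul, abs_pow, abs_neg, abs_one, one_pow, one_mul,
      abs_of_nonneg (by positivity : (0:ℝ) ≤ (j:ℝ) * y ^ (j - 1)), abs_of_nonneg hσ0]
    calc (j:ℝ) * y ^ (j - 1) *
          ∑ A ∈ Finset.powersetCard (j + 1) (Finset.univ : Finset (Fin (n + 2))), ∏ k ∈ A, θ k
        ≤ ((n:ℝ) + 2) * ((n:ℝ) + 2) ^ (n + 1) * (2:ℝ) ^ (n + 2) :=
          mul_le_mul (mul_le_mul hjR hyj (by positivity) (by positivity)) hσ1 hσ0 (by positivity)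
      _ = (2 * ((n:ℝ) + 2)) ^ (n + 2) := by rw [mul_pow, pow_succ' ((n:ℝ) + 2)]; ring
  calc |∑ j ∈ Finset.range (n + 2), (-1:ℝ) ^ j * ((j:ℝ) * y ^ (j - 1)) *
        ∑ A ∈ Finset.powersetCard (j + 1) (Finset.univ : Finset (Fin (n + 2))), ∏ k ∈ A, θ k|
      ≤ ∑ j ∈ Finset.range (n + 2), |(-1:ℝ) ^ j * ((j:ℝ) * y ^ (j - 1)) *
        ∑ A ∈ Finset.powersetCard (j + 1) (Finset.univ : Finset (Fin (n + 2))), ∏ k ∈ A, θ k| :=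
        Finset.abs_sum_le_sum_abs _ _
    _ ≤ ∑ _j ∈ Finset.range (n + 2), (2 * ((n:ℝ) + 2)) ^ (n + 2) := Finset.sum_le_sum hterm
    _ = ((n:ℝ) + 2) * (2 * ((n:ℝ) + 2)) ^ (n + 2) := by
        rw [Finset.sum_const, Finset.card_range, nsmul_eq_mul]; push_cast; ring
    _ ≤ (2 * ((n:ℝ) + 2)) * (2 * ((n:ℝ) + 2)) ^ (n + 2) := by
        gcongr; linarith
    _ = (2 * ((n:ℝ) + 2)) ^ (n + 3) := by ring

/-- **`S ≥ 1/p` on the fibre**: from `yS = 1 − ∏ t_k ≥ 1 − t_m = yθ_m` for every `m` and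
`Σ_m θ_m = 1`. [folklore] -/
theorem inv_le_S {θ : Fin (n + 2) → ℝ} {y Sv : ℝ} (hsum : ∑ k, θ k = 1) (hy : 0 < y)
    (ht0 : ∀ k, 0 ≤ 1 - y * θ k) (ht1 : ∀ k, 1 - y * θ k ≤ 1)
    (hV : y * Sv = 1 - ∏ k, (1 - y * θ k)) : 1 / ((n:ℝ) + 2) ≤ Sv := by
  have hm : ∀ m, θ m ≤ Sv := by
    intro m
    have h1 : ∏ k, (1 - y * θ k) ≤ 1 - y * θ m := by
      rw [← Finset.mul_prod_erase Finset.univ _ (Finset.mem_univ m)]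
      exact mul_le_of_le_one_right (ht0 m)
        (Finset.prod_le_one (fun k _ => ht0 k) fun k _ => ht1 k)
    have h2 : y * θ m ≤ y * Sv := by rw [hV]; linarith
    exact le_of_mul_le_mul_left h2 hy
  have h3 : ∑ k, θ k ≤ ∑ _k : Fin (n + 2), Sv := Finset.sum_le_sum fun k _ => hm k
  rw [hsum, Finset.sum_const, Finset.card_univ, Fintype.card_fin, nsmul_eq_mul] at h3
  push_cast at h3
  rw [div_le_iff₀ (by positivity)]
  linarith

/-- **The cyclic monomial along the fibre**: `M_k = t_k^x ∏_j t_{k+j+1}^{x+(j+1)/p−1}` with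
`t_l = 1 − aθ_l`, `x ≥ 2`, lies in `[0, ∏_l t_l]` (every exponent is `≥ 1`) and has a derivative of
size `≤ p·x` (product rule; every differentiated factor keeps a non-negative exponent). [folklore] -/
theorem monomial {x y : ℝ} {θ : Fin (n + 2) → ℝ} (hx : 2 ≤ x) (hθ0 : ∀ k, 0 ≤ θ k)
    (hθ1 : ∀ k, θ k ≤ 1) (ht0 : ∀ k, 0 < 1 - y * θ k) (ht1 : ∀ k, 1 - y * θ k ≤ 1)
    (k : Fin (n + 2)) (Mf : ℝ → ℝ)
    (hMf : ∀ a, Mf a = (1 - a * θ k) ^ x *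
      ∏ j : Fin (n + 1), (1 - a * θ (k + j.succ)) ^ (x + (((j:ℕ):ℝ) + 1) / ((n:ℝ) + 2) - 1)) :
    (0 ≤ Mf y ∧ Mf y ≤ ∏ l, (1 - y * θ l)) ∧
      ∃ md, HasDerivAt Mf md y ∧ |md| ≤ ((n:ℝ) + 2) * x := by
  have hfrac : ∀ j : Fin (n + 1), 0 ≤ (((j:ℕ):ℝ) + 1) / ((n:ℝ) + 2) ∧
      (((j:ℕ):ℝ) + 1) / ((n:ℝ) + 2) ≤ 1 := by
    intro j
    have hj : ((j:ℕ):ℝ) + 1 ≤ (n:ℝ) + 2 := by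
      have := j.isLt
      have : ((j:ℕ):ℝ) + 1 ≤ (n:ℝ) + 1 := by exact_mod_cast this
      linarith
    exact ⟨by positivity, (div_le_one (by positivity)).2 hj⟩
  have he1 : ∀ j : Fin (n + 1), 1 ≤ x + (((j:ℕ):ℝ) + 1) / ((n:ℝ) + 2) - 1 := fun j => by
    linarith [(hfrac j).1]
  have hex : ∀ j : Fin (n + 1), x + (((j:ℕ):ℝ) + 1) / ((n:ℝ) + 2) - 1 ≤ x := fun j => by
    linarith [(hfrac j).2]
  have dt : ∀ l, HasDerivAt (fun a : ℝ => 1 - a * θ l) (-θ l) y := fun l => by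
    simpa using ((hasDerivAt_id y).mul_const (θ l)).const_sub 1
  -- ranges of the factors at `y`
  have hf0 : ∀ (l : Fin (n + 2)) (e : ℝ), 0 ≤ (1 - y * θ l) ^ e := fun l e => rpow_nonneg (ht0 l).le e
  have hf1 : ∀ (l : Fin (n + 2)) (e : ℝ), 0 ≤ e → (1 - y * θ l) ^ e ≤ 1 := fun l e he =>
    rpow_le_one (ht0 l).le (ht1 l) he
  have hP0 : 0 ≤ ∏ j : Fin (n + 1), (1 - y * θ (k + j.succ)) ^ (x + (((j:ℕ):ℝ) + 1) / ((n:ℝ) + 2) - 1) :=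
    Finset.prod_nonneg fun j _ => hf0 _ _
  have hP1 : ∏ j : Fin (n + 1), (1 - y * θ (k + j.succ)) ^ (x + (((j:ℕ):ℝ) + 1) / ((n:ℝ) + 2) - 1) ≤ 1 :=
    Finset.prod_le_one (fun j _ => hf0 _ _) fun j _ => hf1 _ _ (by linarith [he1 j])
  refine ⟨?_, ?_⟩
  · rw [hMf, ← CornerField.mul_prod_add_succ (fun l => 1 - y * θ l) k]
    refine ⟨mul_nonneg (hf0 k x) hP0, ?_⟩
    refine mul_le_mul (CornerY.rpow_le_self_of_one_le (ht0 k).le (ht1 k) (by linarith)) ?_ hP0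
      (ht0 k).le
    exact Finset.prod_le_prod (fun j _ => hf0 _ _) fun j _ =>
      CornerY.rpow_le_self_of_one_le (ht0 _).le (ht1 _) (he1 j)
  -- the derivative (product rule)
  have dg : HasDerivAt (fun a : ℝ => (1 - a * θ k) ^ x) (-θ k * x * (1 - y * θ k) ^ (x - 1)) y :=
    (dt k).rpow_const (Or.inl (ht0 k).ne')
  have df : ∀ j ∈ (Finset.univ : Finset (Fin (n + 1))),
      HasDerivAt (fun a : ℝ => (1 - a * θ (k + j.succ)) ^ (x + (((j:ℕ):ℝ) + 1) / ((n:ℝ) + 2) - 1))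
        (-θ (k + j.succ) * (x + (((j:ℕ):ℝ) + 1) / ((n:ℝ) + 2) - 1) *
          (1 - y * θ (k + j.succ)) ^ (x + (((j:ℕ):ℝ) + 1) / ((n:ℝ) + 2) - 1 - 1)) y := fun j _ =>
    (dt _).rpow_const (Or.inl (ht0 _).ne')
  have d := dg.fun_mul (HasDerivAt.fun_finsetProd df)
  refine ⟨_, d.congr_of_eventuallyEq (Filter.Eventually.of_forall hMf), ?_⟩
  -- the bound
  have hA : |-θ k * x * (1 - y * θ k) ^ (x - 1) *
      ∏ j : Fin (n + 1), (1 - y * θ (k + j.succ)) ^ (x + (((j:ℕ):ℝ) + 1) / ((n:ℝ) + 2) - 1)| ≤ x := by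
    rw [abs_mul, abs_mul, abs_mul, abs_neg, abs_of_nonneg (hθ0 k), abs_of_nonneg (by linarith : (0:ℝ) ≤ x),
      abs_of_nonneg (hf0 _ _), abs_of_nonneg hP0]
    calc θ k * x * (1 - y * θ k) ^ (x - 1) *
          ∏ j : Fin (n + 1), (1 - y * θ (k + j.succ)) ^ (x + (((j:ℕ):ℝ) + 1) / ((n:ℝ) + 2) - 1)
        ≤ 1 * x * 1 * 1 := by
          refine mul_le_mul (mul_le_mul (mul_le_mul_of_nonneg_right (hθ1 k) (by linarith))
            (hf1 _ _ (by linarith)) (hf0 _ _) (by positivity)) hP1 hP0 (by positivity)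
      _ = x := by ring
  have hB : ∀ j ∈ (Finset.univ : Finset (Fin (n + 1))),
      |(∏ i ∈ Finset.univ.erase j, (1 - y * θ (k + i.succ)) ^ (x + (((i:ℕ):ℝ) + 1) / ((n:ℝ) + 2) - 1)) •
        (-θ (k + j.succ) * (x + (((j:ℕ):ℝ) + 1) / ((n:ℝ) + 2) - 1) *
          (1 - y * θ (k + j.succ)) ^ (x + (((j:ℕ):ℝ) + 1) / ((n:ℝ) + 2) - 1 - 1))| ≤ x := by
    intro j _
    have hQ0 : 0 ≤ ∏ i ∈ Finset.univ.erase j,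
        (1 - y * θ (k + i.succ)) ^ (x + (((i:ℕ):ℝ) + 1) / ((n:ℝ) + 2) - 1) :=
      Finset.prod_nonneg fun i _ => hf0 _ _
    have hQ1 : ∏ i ∈ Finset.univ.erase j,
        (1 - y * θ (k + i.succ)) ^ (x + (((i:ℕ):ℝ) + 1) / ((n:ℝ) + 2) - 1) ≤ 1 :=
      Finset.prod_le_one (fun i _ => hf0 _ _) fun i _ => hf1 _ _ (by linarith [he1 i])
    have he0 : 0 ≤ x + (((j:ℕ):ℝ) + 1) / ((n:ℝ) + 2) - 1 := by linarith [he1 j]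
    rw [smul_eq_mul, abs_mul, abs_of_nonneg hQ0, abs_mul, abs_mul, abs_neg, abs_of_nonneg (hθ0 _),
      abs_of_nonneg he0, abs_of_nonneg (hf0 _ _)]
    calc (∏ i ∈ Finset.univ.erase j, (1 - y * θ (k + i.succ)) ^ (x + (((i:ℕ):ℝ) + 1) / ((n:ℝ) + 2) - 1)) *
          (θ (k + j.succ) * (x + (((j:ℕ):ℝ) + 1) / ((n:ℝ) + 2) - 1) *
            (1 - y * θ (k + j.succ)) ^ (x + (((j:ℕ):ℝ) + 1) / ((n:ℝ) + 2) - 1 - 1))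
        ≤ 1 * (1 * x * 1) := by
          refine mul_le_mul hQ1 (mul_le_mul (mul_le_mul (hθ1 _) (hex j) he0 zero_le_one)
            (hf1 _ _ (by linarith [he1 j])) (hf0 _ _) (by linarith))
            (mul_nonneg (mul_nonneg (hθ0 _) he0) (hf0 _ _)) zero_le_one
      _ = x := by ring
  calc |-θ k * x * (1 - y * θ k) ^ (x - 1) *
          ∏ j : Fin (n + 1), (1 - y * θ (k + j.succ)) ^ (x + (((j:ℕ):ℝ) + 1) / ((n:ℝ) + 2) - 1) +
        (1 - y * θ k) ^ x * ∑ j : Fin (n + 1),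
          (∏ i ∈ Finset.univ.erase j, (1 - y * θ (k + i.succ)) ^ (x + (((i:ℕ):ℝ) + 1) / ((n:ℝ) + 2) - 1)) •
            (-θ (k + j.succ) * (x + (((j:ℕ):ℝ) + 1) / ((n:ℝ) + 2) - 1) *
              (1 - y * θ (k + j.succ)) ^ (x + (((j:ℕ):ℝ) + 1) / ((n:ℝ) + 2) - 1 - 1))|
      ≤ x + 1 * ((n + 1 : ℕ) * x) := by
        refine (abs_add_le _ _).trans (add_le_add hA ?_)
        rw [abs_mul, abs_of_nonneg (hf0 _ _)]
        refine mul_le_mul (hf1 _ _ (by linarith)) ?_ (abs_nonneg _) zero_le_one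
        refine (Finset.abs_sum_le_sum_abs _ _).trans ?_
        calc ∑ j : Fin (n + 1), |(∏ i ∈ Finset.univ.erase j,
              (1 - y * θ (k + i.succ)) ^ (x + (((i:ℕ):ℝ) + 1) / ((n:ℝ) + 2) - 1)) •
              (-θ (k + j.succ) * (x + (((j:ℕ):ℝ) + 1) / ((n:ℝ) + 2) - 1) *
                (1 - y * θ (k + j.succ)) ^ (x + (((j:ℕ):ℝ) + 1) / ((n:ℝ) + 2) - 1 - 1))|
            ≤ ∑ _j : Fin (n + 1), x := Finset.sum_le_sum hB
          _ = (n + 1 : ℕ) * x := by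
            rw [Finset.sum_const, Finset.card_univ, Fintype.card_fin, nsmul_eq_mul]
    _ = ((n:ℝ) + 2) * x := by push_cast; ring

/-- Pole absorption for `Z'·B`: `Z' = Z·(∏t)'/(p∏t)` with `|(∏t)'| ≤ 1`, `Z ∈ [0,1]`, and
`0 ≤ B ≤ ∏ t`, so `|Z'B| ≤ 1`. [folklore] -/
theorem abs_ZB_le {Z pd p PT B Zd : ℝ} (hZ0 : 0 ≤ Z) (hZ1 : Z ≤ 1) (hpd : |pd| ≤ 1) (hp : 1 ≤ p)
    (hPT : 0 < PT) (hB0 : 0 ≤ B) (hBP : B ≤ PT) (hZd : Z * pd / (p * PT) = Zd) :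
    |Zd * B| ≤ 1 := by
  have hp0 : 0 < p := by linarith
  have e : Zd * B = (Z * pd / p) * (B / PT) := by rw [← hZd]; ring
  rw [e, abs_mul, abs_div, abs_mul, abs_of_nonneg hZ0, abs_of_pos hp0,
    abs_of_nonneg (div_nonneg hB0 hPT.le)]
  have h1 : Z * |pd| / p ≤ 1 := by
    rw [div_le_one hp0]
    calc Z * |pd| ≤ 1 * 1 := mul_le_mul hZ1 hpd (abs_nonneg _) zero_le_one
      _ ≤ p := by linarith
  have h2 : B / PT ≤ 1 := div_le_one_of_le₀ hBP hPT.le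
  calc Z * |pd| / p * (B / PT) ≤ 1 * 1 := mul_le_mul h1 h2 (div_nonneg hB0 hPT.le) zero_le_one
    _ = 1 := one_mul _

/-- Pole absorption for `H'·B`: `H' = (N₁Z'S − N S')/S²` with `|Z'B| ≤ 1`, `0 ≤ N₁ ≤ p²`,
`0 ≤ N ≤ p`, `|S'| ≤ C`, `S ≥ 1/p` and `0 ≤ B ≤ 1`, so `|H'B| ≤ p³(1 + C)`. [folklore] -/
theorem abs_HB_le {p N1 N Zd Sv Sd B Hd C : ℝ} (hp : 1 ≤ p) (hZB : |Zd * B| ≤ 1) (hN10 : 0 ≤ N1)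
    (hN1 : N1 ≤ p ^ 2) (hN0 : 0 ≤ N) (hN : N ≤ p) (hSd : |Sd| ≤ C) (hS : 1 / p ≤ Sv)
    (hB0 : 0 ≤ B) (hB1 : B ≤ 1) (hHd : (N1 * Zd * Sv - N * Sd) / Sv ^ 2 = Hd) :
    |Hd * B| ≤ p ^ 3 * (1 + C) := by
  have hp0 : 0 < p := by linarith
  have hS0 : 0 < Sv := lt_of_lt_of_le (by positivity) hS
  have hC : 0 ≤ C := (abs_nonneg _).trans hSd
  have hpS : 1 ≤ p * Sv := by
    rw [div_le_iff₀ hp0] at hS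
    linarith
  have e : Hd * B = (N1 * (Zd * B) * Sv - N * Sd * B) / Sv ^ 2 := by rw [← hHd]; ring
  have a1 : |N1 * (Zd * B) * Sv| ≤ p ^ 2 * 1 * Sv := by
    rw [abs_mul, abs_mul, abs_of_nonneg hN10, abs_of_pos hS0]
    exact mul_le_mul_of_nonneg_right (mul_le_mul hN1 hZB (abs_nonneg _) (by positivity)) hS0.le
  have a2 : |N * Sd * B| ≤ p * C * 1 := by
    rw [abs_mul, abs_mul, abs_of_nonneg hN0, abs_of_nonneg hB0]
    exact mul_le_mul (mul_le_mul hN hSd (abs_nonneg _) hp0.le) hB1 hB0 (by positivity)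
  have b1 : p ^ 2 * 1 * Sv ≤ p ^ 3 * Sv ^ 2 :=
    calc p ^ 2 * 1 * Sv = (p ^ 2 * Sv) * 1 := by ring
      _ ≤ (p ^ 2 * Sv) * (p * Sv) := mul_le_mul_of_nonneg_left hpS (by positivity)
      _ = p ^ 3 * Sv ^ 2 := by ring
  have b2 : p * C * 1 ≤ p ^ 3 * C * Sv ^ 2 :=
    calc p * C * 1 ≤ (p * C) * (p * Sv) ^ 2 :=
          mul_le_mul_of_nonneg_left (one_le_pow₀ hpS) (by positivity)
      _ = p ^ 3 * C * Sv ^ 2 := by ring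
  rw [e, abs_div, abs_of_pos (by positivity : (0:ℝ) < Sv ^ 2), div_le_iff₀ (by positivity)]
  calc |N1 * (Zd * B) * Sv - N * Sd * B| ≤ p ^ 2 * 1 * Sv + p * C * 1 :=
        (abs_sub _ _).trans (add_le_add a1 a2)
    _ ≤ p ^ 3 * Sv ^ 2 + p ^ 3 * C * Sv ^ 2 := add_le_add b1 b2
    _ = p ^ 3 * (1 + C) * Sv ^ 2 := by ring

/-- Assembling the three bounded terms of `∂_y V_y`. [folklore] -/
theorem three_terms_le {E k a1 a2 Ga Gb v Ha Hb Q ZB HB Bd C2 C3 : ℝ} (ha1 : 0 ≤ a1)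
    (ha2 : 0 ≤ a2) (hv0 : 0 ≤ v) (hv1 : v ≤ 1) (hE0 : 0 ≤ E) (hE1 : E ≤ 1) (hk0 : 0 ≤ k)
    (hk1 : k ≤ 1) (hGa0 : 0 ≤ Ga) (hGa1 : Ga ≤ 1) (hGb0 : 0 ≤ Gb) (hGb1 : Gb ≤ 1) (hQ : 0 ≤ Q)
    (hHa0 : 0 ≤ Ha) (hHaQ : Ha ≤ Q) (hHb0 : 0 ≤ Hb) (hHbQ : Hb ≤ Q)
    (hZB : |ZB| ≤ 1) (hHB : |HB| ≤ C2) (hBd : |Bd| ≤ C3) :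
    |-(E * k * a1 * Gb * v * Ha) * ZB + E * k * a2 * Ga * Hb * HB + E * Ga * Ha * k * Bd| ≤
      Q * (a1 + a2 * C2 + C3) := by
  have hEk : E * k ≤ 1 := mul_le_one₀ hE1 hk0 hk1
  have hC2 : 0 ≤ C2 := (abs_nonneg _).trans hHB
  have hC3 : 0 ≤ C3 := (abs_nonneg _).trans hBd
  have hT1 : |-(E * k * a1 * Gb * v * Ha) * ZB| ≤ a1 * Q := by
    rw [abs_mul, abs_neg, abs_of_nonneg (by positivity)]
    have a : E * k * a1 * Gb * v * Ha ≤ 1 * a1 * 1 * 1 * Q :=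
      mul_le_mul (mul_le_mul (mul_le_mul (mul_le_mul_of_nonneg_right hEk ha1) hGb1 hGb0
        (by positivity)) hv1 hv0 (by positivity)) hHaQ hHa0 (by positivity)
    calc E * k * a1 * Gb * v * Ha * |ZB| ≤ (1 * a1 * 1 * 1 * Q) * 1 :=
          mul_le_mul a hZB (abs_nonneg _) (by positivity)
      _ = a1 * Q := by ring
  have hT2 : |E * k * a2 * Ga * Hb * HB| ≤ a2 * Q * C2 := by
    rw [abs_mul, abs_of_nonneg (by positivity)]
    have a : E * k * a2 * Ga * Hb ≤ 1 * a2 * 1 * Q :=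
      mul_le_mul (mul_le_mul (mul_le_mul_of_nonneg_right hEk ha2) hGa1 hGa0 (by positivity))
        hHbQ hHb0 (by positivity)
    calc E * k * a2 * Ga * Hb * |HB| ≤ (1 * a2 * 1 * Q) * C2 :=
          mul_le_mul a hHB (abs_nonneg _) (by positivity)
      _ = a2 * Q * C2 := by ring
  have hT3 : |E * Ga * Ha * k * Bd| ≤ Q * C3 := by
    rw [abs_mul, abs_of_nonneg (by positivity)]
    have a : E * Ga * Ha * k ≤ 1 * Q * 1 :=
      mul_le_mul (mul_le_mul (mul_le_one₀ hE1 hGa0 hGa1) hHaQ hHa0 zero_le_one) hk1 hk0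
        (by positivity)
    calc E * Ga * Ha * k * |Bd| ≤ (1 * Q * 1) * C3 := mul_le_mul a hBd (abs_nonneg _) (by positivity)
      _ = Q * C3 := by ring
  calc |-(E * k * a1 * Gb * v * Ha) * ZB + E * k * a2 * Ga * Hb * HB + E * Ga * Ha * k * Bd|
      ≤ |-(E * k * a1 * Gb * v * Ha) * ZB| + |E * k * a2 * Ga * Hb * HB| +
        |E * Ga * Ha * k * Bd| := abs_add_three _ _ _
    _ ≤ a1 * Q + a2 * Q * C2 + Q * C3 := add_le_add (add_le_add hT1 hT2) hT3
    _ = Q * (a1 + a2 * C2 + C3) := by ring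

end CornerYDerivBound

/-- **The cyclic monomial along a `y`-fibre** (sub-goal `cornerYDerivBoundGenAux` of the stub
`cornerYDerivBoundGen`, dimension `p = n + 2`): for weights `θ_l ∈ [0,1]`, box coordinates
`t_l = 1 − yθ_l ∈ (0,1]` and `x ≥ 2`, the monomial `M_k(a) = (1 − aθ_k)^x ∏_j (1 − aθ_{k+j+1})^{x+(j+1)/p−1}`
satisfies `0 ≤ M_k(y) ≤ ∏_l t_l` and has a derivative at `y` of size `≤ p·x`.
[cite: KontsevichZagier2001, §1.2 rule (3)] -/
theorem cornerYDerivBoundGenAux : ∀ (n : ℕ) (x y : ℝ) (θ : Fin (n + 2) → ℝ), 2 ≤ x → (∀ k, 0 ≤ θ k) → (∀ k, θ k ≤ 1) → (∀ k, 0 < 1 - y * θ k) → (∀ k, 1 - y * θ k ≤ 1) → ∀ (k : Fin (n + 2)) (Mf : ℝ → ℝ), (∀ a, Mf a = (1 - a * θ k) ^ x * ∏ j : Fin (n + 1), (1 - a * θ (k + j.succ)) ^ (x + (((j:ℕ):ℝ) + 1) / ((n:ℝ) + 2) - 1)) → (0 ≤ Mf y ∧ Mf y ≤ ∏ l, (1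 - y * θ l)) ∧ ∃ md : ℝ, HasDerivAt Mf md y ∧ |md| ≤ ((n:ℝ) + 2) * x :=
  fun _ _ _ _ hx hθ0 hθ1 ht0 ht1 k Mf hMf => CornerYDerivBound.monomial hx hθ0 hθ1 ht0 ht1 k Mf hMf

end Summit.KontsevichZagierPeriods.TerasomaMultiplication.MultiplicationAccessible

end
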